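import Mathlib
import Literature.Algebra.Polynomial.SylvesterRuleOfSigns

/-!
# Venture HSemireg — the apolar Gram matrix `((x_i − x_j)^n)`: the PARITY CELLS of the rank theorem

HONEST FRAMING. Finite-dimensional real linear algebra only (one real matrix attached to `ρ` real
«atoms»); no variety, no sheaf, no semiregularity map is constructed; nothing here says that HC /
HC_CM / HC_AV holds; no Literature fact is declared or assumed — the one input is the PROVED
Literature theorem `Literature.Algebra.Polynomial.sylvester_rule_of_signs` (Sylvester 1865 /
Pólya–Szegő II, Part V, Problem 79).

Context (cell pub-hsemireg, theory/FORMULA-N.md PART A §2.9 = theory/th6/apolar/APOLAR-GRAM-RANK-th6g8.md,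
THEOREM A; th-7's ONE-SIDED RANK LAW, PART B §L.11–§L.12; p6's kernel theorems
`weilPurity_oneSided_b_zero` / `finrank_map_psiMP` reduce that law to the number
`rank(H_n Ω_n H_n)`, which for exponential Hankel data with distinct real atoms is the rank of the
matrix below). For distinct real atoms `x_0 < … < x_{ρ−1}` put `G = gram n x := ((x_i − x_j)^n)_{i,j}`.
THEOREM A says: for `ρ ≤ n+1`, `rank G = ρ − [ρ = 1]` (`n` even) and `= 2⌊ρ/2⌋` (`n` odd). This file
proves its PARITY HALF, which is a counting corollary of Sylvester's rule of signs:

* `cyclicSignChanges_mod_two` — the number `C` of changes of sign of `a 0, …, a (s−1), (−1)^m a 0`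
  (no zero terms) satisfies `C ≡ m (mod 2)` (the product of the `s` cyclically consecutive twisted
  products is `(−1)^m ∏ a_i²`).
* `gram_mulVec_eq_zero` — if `2 ≤ ρ ≤ n + 1` and `ρ ≢ n (mod 2)`, then `G c = 0 ⇒ c = 0`
  (cells (n even, ρ odd) and (n odd, ρ even) of THEOREM A: `G` is non-singular).
  Proof: a kernel vector `c` with support `S` (`s = |S|`) makes the Sylvester form
  `P = Σ_{ν∈S} c_ν (X − x_ν)^n` vanish at ALL `ρ` nodes; `P ≠ 0` by a Vandermonde argument
  (`s ≤ n+1`); `s = 1` is impossible directly, and for `s ≥ 2` Sylvester gives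
  `ρ ≤ #Z(P) ≤ C ≤ s ≤ ρ`, so `C = ρ`, contradicting `C ≡ n (mod 2)`.

NOT here (sized L, see the .md §3): the cells `ρ ≡ n (mod 2)` (`n` even: non-singular via
connectedness of the configuration space + a circulant evaluation + a 2×2 Schur step; `n` odd:
corank exactly 1), the sign/inertia law A′.
-/

noncomputable section

open Polynomial Finset Matrix
open Literature.Algebra.Polynomial
open scoped BigOperators

namespace Summit.Ventures.HSemireg.ApolarGram

/-- The apolar Gram matrix `G_n(x) = ((x_i − x_j)^n)_{i,j}` of the atoms `x`. -/
def gram (n : ℕ) {ρ : ℕ} (x : Fin ρ → ℝ) : Matrix (Fin ρ) (Fin ρ) ℝ :=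
  Matrix.of fun i j => (x i - x j) ^ n

/-- the rows of `G c`: `(G c)_j = Σ_ν c_ν (x_j − x_ν)^n`. -/
theorem gram_mulVec (n : ℕ) {ρ : ℕ} (x : Fin ρ → ℝ) (c : Fin ρ → ℝ) (j : Fin ρ) :
    (gram n x).mulVec c j = ∑ ν, c ν * (x j - x ν) ^ n := by
  simp only [gram, Matrix.mulVec, dotProduct, Matrix.of_apply]
  exact Finset.sum_congr rfl fun ν _ => mul_comm _ _

/-! ### The parity of the cyclic sign-change count -/

/-- The product of all twisted products around the necklace is `(−1)^m ∏ a_i²`. -/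
theorem prod_twistedProd (m : ℕ) {k : ℕ} (a : Fin (k + 1) → ℝ) :
    ∏ i, twistedProd m a i = (-1) ^ m * ∏ i, a i ^ 2 := by
  rw [Fin.prod_univ_castSucc]
  have hcs : ∀ i : Fin k, twistedProd m a (Fin.castSucc i) = a (Fin.castSucc i) * a (Fin.succ i) := by
    intro i
    rw [twistedProd_of_lt m a (Fin.castSucc i) (by simp)]
    rfl
  have hlast : twistedProd m a (Fin.last k) = (-1) ^ m * (a (Fin.last k) * a 0) := by
    rw [twistedProd_of_not_lt m a (Fin.last k) (by simp)]
    rfl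
  simp_rw [hcs, hlast, Finset.prod_mul_distrib]
  have h1 : (∏ i : Fin k, a (Fin.castSucc i)) * a (Fin.last k) = ∏ i, a i :=
    (Fin.prod_univ_castSucc a).symm
  have h2 : a 0 * ∏ i : Fin k, a (Fin.succ i) = ∏ i, a i := (Fin.prod_univ_succ a).symm
  have h3 : ∏ i : Fin (k + 1), a i ^ 2 = (∏ i, a i) * ∏ i, a i := by
    rw [← Finset.prod_mul_distrib]; exact Finset.prod_congr rfl fun i _ => sq (a i)
  rw [h3]
  nth_rewrite 1 [← h1]
  rw [← h2]
  ring

/-- `C ≡ m (mod 2)`: the number of changes of sign of `a 0, …, a (s−1), (−1)^m a 0` (all `a i ≠ 0`,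
`s ≥ 1`) has the parity of `m`. -/
theorem cyclicSignChanges_mod_two (m : ℕ) {s : ℕ} (hs : 0 < s) (a : Fin s → ℝ) (ha : ∀ i, a i ≠ 0) :
    cyclicSignChanges m a % 2 = m % 2 := by
  classical
  obtain ⟨k, rfl⟩ := Nat.exists_eq_succ_of_ne_zero hs.ne'
  set t := twistedProd m a with ht
  set N := (univ.filter fun i => t i < 0) with hN
  have hC : cyclicSignChanges m a = N.card := rfl
  have htne : ∀ i, t i ≠ 0 := by
    intro i
    by_cases h : i.val + 1 < k + 1
    · rw [ht, twistedProd_of_lt m a i h]; exact mul_ne_zero (ha _) (ha _)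
    · rw [ht, twistedProd_of_not_lt m a i h]
      exact mul_ne_zero (pow_ne_zero _ (by norm_num)) (mul_ne_zero (ha _) (ha _))
  -- split the product
  have hsplit : (∏ i ∈ N, t i) * ∏ i ∈ univ.filter (fun i => ¬ t i < 0), t i = ∏ i, t i :=
    Finset.prod_filter_mul_prod_filter_not _ _ _
  have hneg : ∏ i ∈ N, t i = (-1) ^ N.card * ∏ i ∈ N, (-t i) := by
    rw [Finset.pow_card_mul_prod]
    exact Finset.prod_congr rfl fun i _ => by ring
  have hP1 : 0 < ∏ i ∈ N, (-t i) :=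
    Finset.prod_pos fun i hi => neg_pos.2 (mem_filter.1 hi).2
  have hP2 : 0 < ∏ i ∈ univ.filter (fun i => ¬ t i < 0), t i :=
    Finset.prod_pos fun i hi => lt_of_le_of_ne (not_lt.1 (mem_filter.1 hi).2) (htne i).symm
  have hQ : 0 < ∏ i, a i ^ 2 := Finset.prod_pos fun i _ => pow_pos_of_ne_zero' (ha i)
  have hprod := prod_twistedProd m a
  rw [← hsplit, hneg] at hprod
  -- (−1)^|N| · P1 · P2 = (−1)^m · Q with P1, P2, Q > 0 forces the parities to agree
  have hPP : 0 < (∏ i ∈ N, (-t i)) * ∏ i ∈ univ.filter (fun i => ¬ t i < 0), t i := mul_pos hP1 hP2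
  rw [hC]
  rcases Nat.even_or_odd N.card with hN2 | hN2 <;> rcases Nat.even_or_odd m with hm2 | hm2
  · rw [Nat.even_iff.1 hN2, Nat.even_iff.1 hm2]
  · exfalso
    rw [hN2.neg_one_pow, hm2.neg_one_pow, one_mul] at hprod
    linarith
  · exfalso
    rw [hN2.neg_one_pow, hm2.neg_one_pow, one_mul] at hprod
    linarith
  · rw [Nat.odd_iff.1 hN2, Nat.odd_iff.1 hm2]
where
  /-- a non-zero real has positive square -/
  pow_pos_of_ne_zero' {r : ℝ} (h : r ≠ 0) : 0 < r ^ 2 := by positivity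

/-! ### Restriction of a vector to its support, in increasing order -/

section Support

variable {ρ : ℕ} (c : Fin ρ → ℝ)

/-- the support of `c` -/
def supp : Finset (Fin ρ) := univ.filter fun ν => c ν ≠ 0

/-- the increasing enumeration of the support -/
def suppEmb : Fin (supp c).card ↪o Fin ρ := (supp c).orderEmbOfFin rfl

/-- the enumeration lands in the support -/
theorem suppEmb_mem (i : Fin (supp c).card) : suppEmb c i ∈ supp c :=
  (supp c).orderEmbOfFin_mem rfl i

/-- the enumerated coefficients are non-zero -/
theorem ne_zero_suppEmb (i : Fin (supp c).card) : c (suppEmb c i) ≠ 0 :=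
  (mem_filter.1 (suppEmb_mem c i)).2

/-- a sum weighted by `c` is a sum over the enumerated support -/
theorem sum_eq_sum_supp (f : Fin ρ → ℝ) :
    ∑ ν, c ν * f ν = ∑ i : Fin (supp c).card, c (suppEmb c i) * f (suppEmb c i) := by
  classical
  have h1 : ∑ ν, c ν * f ν = ∑ ν ∈ supp c, c ν * f ν := by
    refine (Finset.sum_subset (subset_univ _) fun ν _ hν => ?_).symm
    have : ¬ c ν ≠ 0 := fun h => hν (mem_filter.2 ⟨mem_univ _, h⟩)
    rw [not_not.1 this, zero_mul]
  rw [h1, ← Finset.sum_coe_sort (supp c)]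
  rw [← Equiv.sum_comp ((supp c).orderIsoOfFin rfl).toEquiv]
  rfl

end Support

/-! ### The Sylvester form attached to a kernel vector -/

/-- coefficients of `(X − C r)^n`. -/
theorem coeff_X_sub_C_pow (r : ℝ) (n k : ℕ) :
    ((X - C r) ^ n).coeff k = (-r) ^ (n - k) * (n.choose k : ℝ) := by
  rw [sub_eq_add_neg, ← C_neg, coeff_X_add_C_pow]

/-- A Sylvester form `Σ_{i<s} a i (X − lam i)^n` with `1 ≤ s ≤ n + 1` terms, all `a i ≠ 0` and
distinct nodes is not the zero polynomial (its moments `Σ a i (−lam i)^j`, `j ≤ n`, would vanish: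
Vandermonde). -/
theorem sylvesterForm_ne_zero {n s : ℕ} (hs : s ≤ n + 1) (hs1 : 1 ≤ s) (a lam : Fin s → ℝ)
    (ha : ∀ i, a i ≠ 0) (hlam : Function.Injective lam) : sylvesterForm n a lam ≠ 0 := by
  intro hP
  -- moments vanish: Σ_i a i (−lam i)^j = 0 for j ≤ n
  have hmom : ∀ j, j ≤ n → ∑ i, a i * (-lam i) ^ j = 0 := by
    intro j hj
    have hcoeff : (sylvesterForm n a lam).coeff (n - j) = 0 := by rw [hP, coeff_zero]
    rw [sylvesterForm, finsetSum_coeff] at hcoeff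
    simp_rw [coeff_C_mul, coeff_X_sub_C_pow, Nat.sub_sub_self hj] at hcoeff
    have hch : (n.choose (n - j) : ℝ) ≠ 0 := by
      exact_mod_cast (Nat.choose_pos (Nat.sub_le n j)).ne'
    have : (∑ i, a i * (-lam i) ^ j) * (n.choose (n - j) : ℝ) = 0 := by
      rw [Finset.sum_mul]; simpa [mul_assoc] using hcoeff
    exact (mul_eq_zero.1 this).resolve_right hch
  -- Vandermonde on the nodes −lam
  have hinj : Function.Injective (fun i => -lam i) := fun i j h => hlam (neg_injective h)
  have hdet : (Matrix.vandermonde (fun i => -lam i)).det ≠ 0 :=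
    Matrix.det_vandermonde_ne_zero_iff.2 hinj
  have hvec : Matrix.vecMul a (Matrix.vandermonde fun i => -lam i) = 0 := by
    funext j
    rw [Matrix.vecMul, dotProduct]
    simp only [Matrix.vandermonde_apply, Pi.zero_apply]
    exact hmom j (by have := j.isLt; omega)
  have ha0 := Matrix.eq_zero_of_vecMul_eq_zero hdet hvec
  exact ha ⟨0, hs1⟩ (congrFun ha0 ⟨0, hs1⟩)

/-! ### The parity cells of the rank theorem -/

/-- **Parity cells of the apolar Gram rank theorem.** For `2 ≤ ρ ≤ n + 1` distinct increasing real
atoms and `ρ ≢ n (mod 2)`, the matrix `((x_i − x_j)^n)_{i,j ≤ ρ}` has trivial kernel. -/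
theorem gram_mulVec_eq_zero {n ρ : ℕ} (hρ : 2 ≤ ρ) (hρn : ρ ≤ n + 1) (hpar : ρ % 2 ≠ n % 2)
    {x : Fin ρ → ℝ} (hx : StrictMono x) {c : Fin ρ → ℝ} (hc : (gram n x).mulVec c = 0) :
    c = 0 := by
  classical
  by_contra hne
  obtain ⟨ν₀, hν₀⟩ : ∃ ν, c ν ≠ 0 := by
    by_contra h
    push Not at h
    exact hne (funext h)
  -- the rows of `G c = 0`
  have hrow : ∀ j, ∑ ν, c ν * (x j - x ν) ^ n = 0 := fun j => by
    rw [← gram_mulVec]; exact congrFun hc j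
  set s := (supp c).card with hs
  have hs1 : 1 ≤ s := Finset.card_pos.2 ⟨ν₀, mem_filter.2 ⟨mem_univ _, hν₀⟩⟩
  have hsρ : s ≤ ρ := by
    have := Finset.card_le_univ (supp c); simpa using this
  -- restricted data
  set a' : Fin s → ℝ := fun i => c (suppEmb c i) with ha'
  set lam' : Fin s → ℝ := fun i => x (suppEmb c i) with hlam'
  have ha'ne : ∀ i, a' i ≠ 0 := fun i => ne_zero_suppEmb c i
  have hlam'mono : StrictMono lam' := hx.comp (suppEmb c).strictMono
  set P := sylvesterForm n a' lam' with hPdef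
  have hPeval : ∀ j, P.eval (x j) = 0 := by
    intro j
    rw [hPdef, eval_sylvesterForm, ← hrow j, sum_eq_sum_supp c (fun ν => (x j - x ν) ^ n)]
  have hP : P ≠ 0 := sylvesterForm_ne_zero (hsρ.trans hρn) hs1 a' lam' ha'ne hlam'mono.injective
  -- all ρ nodes are roots of P
  have hcard : ρ ≤ P.roots.toFinset.card := by
    have himg : univ.image x ⊆ P.roots.toFinset := by
      intro y hy
      obtain ⟨j, -, rfl⟩ := mem_image.1 hy
      rw [Multiset.mem_toFinset, mem_roots hP]
      exact hPeval j
    have := Finset.card_le_card himg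
    rwa [Finset.card_image_of_injective _ hx.injective, card_univ, Fintype.card_fin] at this
  rcases Nat.lt_or_ge s 2 with hs2 | hs2
  · -- s = 1: P = a'₀ (X − lam'₀)^n has exactly one root, but ρ ≥ 2 nodes are roots
    have hs_eq : s = 1 := by omega
    have hsingle : ∀ j, c (suppEmb c ⟨0, hs1⟩) * (x j - x (suppEmb c ⟨0, hs1⟩)) ^ n = 0 := by
      intro j
      have h := hrow j
      rw [sum_eq_sum_supp c (fun ν => (x j - x ν) ^ n)] at h
      have huniv : (univ : Finset (Fin s)) = {⟨0, hs1⟩} := by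
        apply Finset.eq_singleton_iff_unique_mem.2
        exact ⟨mem_univ _, fun i _ => Fin.ext (by have := i.isLt; omega)⟩
      rw [huniv, Finset.sum_singleton] at h
      exact h
    -- pick a node different from the support point
    obtain ⟨j, hj⟩ : ∃ j : Fin ρ, j ≠ suppEmb c ⟨0, hs1⟩ := by
      by_cases h0 : (suppEmb c ⟨0, hs1⟩).val = 0
      · exact ⟨⟨1, by omega⟩, fun h => by have := congrArg Fin.val h; simp at this; omega⟩
      · exact ⟨⟨0, by omega⟩, fun h => by have := congrArg Fin.val h; simp at this; omega⟩
    have hxj : x j - x (suppEmb c ⟨0, hs1⟩) ≠ 0 := sub_ne_zero.2 (fun h => hj (hx.injective h))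
    have := hsingle j
    exact (mul_ne_zero (ne_zero_suppEmb c ⟨0, hs1⟩) (pow_ne_zero _ hxj)) this
  · -- s ≥ 2: Sylvester's rule of signs and the parity of C
    have hsyl := sylvester_rule_of_signs n hs2 a' lam' ha'ne hlam'mono hP
    rw [← hPdef] at hsyl
    have hCle : cyclicSignChanges n a' ≤ s := by
      unfold cyclicSignChanges
      have := Finset.card_filter_le (univ : Finset (Fin s)) (fun i => twistedProd n a' i < 0)
      simpa using this
    have hCeq : cyclicSignChanges n a' = ρ := by omega
    have hparity : cyclicSignChanges n a' % 2 = n % 2 := cyclicSignChanges_mod_two n hs1 a' ha'ne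
    omega


/-! ### `n` odd, `ρ` odd: corank exactly one -/

/-- For `n` odd the Gram matrix is alternating: `G j i = − G i j`. -/
theorem gram_transpose_of_odd {n ρ : ℕ} (hn : Odd n) (x : Fin ρ → ℝ) :
    (gram n x)ᵀ = -gram n x := by
  ext i j
  simp only [gram, Matrix.transpose_apply, Matrix.of_apply, Matrix.neg_apply]
  rw [← hn.neg_pow, neg_sub]

/-- `n` odd, `ρ` odd: `det G = 0` (an alternating matrix of odd size). -/
theorem det_gram_eq_zero_of_odd {n ρ : ℕ} (hn : Odd n) (hρ : Odd ρ) (x : Fin ρ → ℝ) :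
    (gram n x).det = 0 := by
  have h := Matrix.det_transpose (gram n x)
  rw [gram_transpose_of_odd hn, Matrix.det_neg, Fintype.card_fin, hρ.neg_one_pow] at h
  linarith

/-- A kernel vector with vanishing LAST coordinate is zero (its restriction to the first `ρ − 1`
nodes lies in the kernel of the principal submatrix, which is a parity cell). -/
theorem gram_mulVec_eq_zero_of_last {n ρ : ℕ} (hρ : 3 ≤ ρ + 1) (hρn : ρ + 1 ≤ n + 1)
    (hpar : ρ % 2 ≠ n % 2) {x : Fin (ρ + 1) → ℝ} (hx : StrictMono x) {c : Fin (ρ + 1) → ℝ}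
    (hc : (gram n x).mulVec c = 0) (hlast : c (Fin.last ρ) = 0) : c = 0 := by
  -- the restriction to the first ρ coordinates is in the kernel of the principal submatrix
  have hsub : (gram n (x ∘ Fin.castSucc)).mulVec (c ∘ Fin.castSucc) = 0 := by
    funext j
    have h := congrFun hc (Fin.castSucc j)
    rw [gram_mulVec, Fin.sum_univ_castSucc, hlast, zero_mul, add_zero] at h
    rw [gram_mulVec]
    simpa using h
  have hzero := gram_mulVec_eq_zero (by omega) (by omega) hpar
    (hx.comp Fin.strictMono_castSucc) hsub
  funext i
  rcases Fin.eq_castSucc_or_eq_last i with ⟨j, rfl⟩ | rfl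
  · exact congrFun hzero j
  · exact hlast

/-- **Cell (n odd, ρ odd) of the rank theorem: corank EXACTLY one.** For `n` odd, `ρ + 1` odd with
`3 ≤ ρ + 1 ≤ n + 1` distinct increasing atoms: the kernel of `((x_i − x_j)^n)` is non-trivial, and
a kernel vector is determined by its last coordinate (so the kernel is a line; `rank = ρ = 2⌊(ρ+1)/2⌋`). -/
theorem gram_ker_line_of_odd {n ρ : ℕ} (hn : Odd n) (hρodd : Odd (ρ + 1)) (hρ : 3 ≤ ρ + 1)
    (hρn : ρ + 1 ≤ n + 1) {x : Fin (ρ + 1) → ℝ} (hx : StrictMono x) :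
    (∃ c : Fin (ρ + 1) → ℝ, c ≠ 0 ∧ (gram n x).mulVec c = 0) ∧
    (∀ c d : Fin (ρ + 1) → ℝ, (gram n x).mulVec c = 0 → (gram n x).mulVec d = 0 →
        c (Fin.last ρ) • d = d (Fin.last ρ) • c) := by
  classical
  have hpar : ρ % 2 ≠ n % 2 := by
    rcases hn with ⟨a, ha⟩; rcases hρodd with ⟨b, hb⟩; omega
  refine ⟨?_, ?_⟩
  · obtain ⟨c, hc, hGc⟩ := Matrix.exists_mulVec_eq_zero_iff.2 (det_gram_eq_zero_of_odd hn hρodd x)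
    exact ⟨c, hc, hGc⟩
  · intro c d hc hd
    -- e := c_last • d − d_last • c is a kernel vector with last coordinate 0
    have he : (gram n x).mulVec (c (Fin.last ρ) • d - d (Fin.last ρ) • c) = 0 := by
      rw [Matrix.mulVec_sub, Matrix.mulVec_smul, Matrix.mulVec_smul, hc, hd, smul_zero, smul_zero,
        sub_zero]
    have hl : (c (Fin.last ρ) • d - d (Fin.last ρ) • c) (Fin.last ρ) = 0 := by
      simp [mul_comm]
    have := gram_mulVec_eq_zero_of_last hρ hρn hpar hx he hl
    exact sub_eq_zero.1 this

end Summit.Ventures.HSemireg.ApolarGram
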